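import Literature.AnabelianGeometry.EtaleTheta.TemperedFrobenioidCor38Sub
import HarnessLib

/-!
# [EtTh] Cor. 3.8, proof row C38-L02a `PreservesPreSteps` (F-2809): the RIGHT-ABSORBED arrows are pre-steps,
# and EVERY record `h : Cor38Hyp C₁ C₂` carries them to pre-steps

S. Mochizuki, *The étale theta function …*, Publ. RIMS **45** (2009), Cor. 3.8 proof, PDF p. 81 l.2–3 ("by [FrdI],
Theorem 3.4, (ii) … `Ψ` preserves pre-steps") [cite: MochizukiEtTh2009, Cor 3.8 p.81]; S. Mochizuki, *The geometry of
Frobenioids I* (2008), Def. 1.2 (iii) p.22 (pre-step = linear base-isomorphism), Thm. 5.2 (i) p.100 (the model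
category: `deg_Fr(ψ ∘ φ) = deg_Fr(ψ)·deg_Fr(φ)`, `Base(ψ ∘ φ) = Base(ψ) ∘ Base(φ)`), §0 p.15 ("totally epimorphic"),
Example 3.5 p.353 (the `F × F` factor swap "clearly fails to preserve pre-steps" over a base that "fails to be of
FSMFF-type") [cite: MochizukiFrdI2008, Thm. 5.2 (i) p.100].

abc-iut cell, block C / F, seat abc-iut-f-130 (gen 5).  PROOF-ONLY census file for FACT-LIST row F-2809 (the bare universal
closure `∀ h : Cor38Hyp C₁ C₂, h.PreservesPreSteps`, UNDECIDED in the kernel; instance forms PROVED by abc-iut-f-001 /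
abc-iut-L1-t13).  WHAT IS PROVED HERE, for ALL typed Def. 3.6 (ii) data (every vocabulary, every pull-back, every `B`):
* `TemperedFrobenioid.degFr_eq_one_of_comp_eq_self` / `baseMap_eq_id_of_comp_eq_self` / `isPreStep_of_comp_eq_self`:
  in the model category of a tempered Frobenioid, an arrow `y` that is ABSORBED ON THE RIGHT by some arrow `x`
  (`x ≫ y = x`) is a linear base-identity endomorphism, hence a pre-step — `deg_Fr` is cancelled in `ℕ_{≥1}`, and
  `Base(x)` is an epimorphism of the totally epimorphic base `D` (Def. 3.6 (ii)), so `Base(x) ≫ Base(y) = Base(x)`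
  forces `Base(y) = id`;  dually `degFr_eq_one_of_self_comp_eq` (`y ≫ x = x` ⇒ `y` linear; no base conclusion, `D`
  need not be totally monomorphic);
* `Cor38Hyp.functor_map_isPreStep_of_comp_eq_self` / `inverse_map_isPreStep_of_comp_eq_self`: since `x ≫ y = x` is
  transported by any functor, EVERY `h : Cor38Hyp C₁ C₂` (no [FrdI] Thm. 3.4 input, no type hypothesis) carries
  right-absorbed arrows of `C₁` to pre-steps of `C₂` and conversely — the universal closure of F-2809 HOLDS on this
  class.  CENSUS CONSEQUENCE (desk notes HOME/staging/f/f-130/g3 (c), HOME/staging/L1/L1-t13/g7 §A): the "junk"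
  translations `t_c = (1, id, c, 1)` of the absorbed-constant families (`c + z = z` for genuine `z`, so `T ≫ t_c = T`)
  are right-absorbed, hence can never witness `¬ F-2809`; a separating model must move an HONEST pre-step.
HONEST FRAMING: bookkeeping about OUR typed interface; nothing here bears on [EtTh] Cor. 3.8 as printed or on
[IUTchIII] Cor. 3.12; no side taken; typed ≠ proved; the row F-2809 stays conditional / instance-proved.
-/

namespace Literature.AnabelianGeometry.EtaleTheta

open CategoryTheory Opposite Literature.AlgebraicGeometry.Frobenioids

universe u₀ v₀ u v w

variable {D₀ : Type u₀} [Category.{v₀} D₀] {V : FrdIMonoidStub.{w}}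
  {T : RealifiedDivisorMonoids (D₀ := D₀) V} {D : Type u} [Category.{v} D] {VD : FrdICatStub.{u, v, w} D}

namespace TemperedFrobenioid

variable (C : TemperedFrobenioid T D VD)

/-- **Right-absorbed ⇒ linear.** If `x ≫ y = x` in the model category of a tempered Frobenioid, then
`deg_Fr(y) = 1`: `deg_Fr(x ≫ y) = deg_Fr(y) · deg_Fr(x)` ([FrdI] Thm. 5.2 (i)) and `ℕ_{≥1}` is cancellative.
[cite: MochizukiFrdI2008, Thm. 5.2 (i) p.100] -/
theorem degFr_eq_one_of_comp_eq_self {X Y : C.category} (x : X ⟶ Y) (y : Y ⟶ Y) (h : x ≫ y = x) :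
    ModelFrobenioid.degFr y = 1 := by
  have hd : ModelFrobenioid.degFr y * ModelFrobenioid.degFr x = 1 * ModelFrobenioid.degFr x := by
    rw [← ModelFrobenioid.degFr_comp, h, one_mul]
  exact mul_right_cancel hd

/-- **Left-absorbing ⇒ linear** (the dual degree count): if `y ≫ x = x` then `deg_Fr(y) = 1`.  (No conclusion
on `Base(y)`: the base category is totally EPImorphic, not totally monomorphic — cf. the admissible one-object
base `⟨a, b ∣ b a = b⟩`, where `a ≫ b = b` with `a ≠ id`.) [cite: MochizukiFrdI2008, Thm. 5.2 (i) p.100] -/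
theorem degFr_eq_one_of_self_comp_eq {X Y : C.category} (y : X ⟶ X) (x : X ⟶ Y) (h : y ≫ x = x) :
    ModelFrobenioid.degFr y = 1 := by
  have hd : ModelFrobenioid.degFr x * ModelFrobenioid.degFr y = ModelFrobenioid.degFr x * 1 := by
    rw [← ModelFrobenioid.degFr_comp, h, mul_one]
  exact mul_left_cancel hd

/-- **Right-absorbed ⇒ base-identity.** If `x ≫ y = x`, then `Base(y) = id`: `Base(x) ≫ Base(y) = Base(x ≫ y) =
Base(x)` and `Base(x)` is an epimorphism, `D` being totally epimorphic (Def. 3.6 (ii), "`D` … a connected, totally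
epimorphic category"; [FrdI] §0 p.15). [cite: MochizukiEtTh2009, Def 3.6 p.77] -/
theorem baseMap_eq_id_of_comp_eq_self {X Y : C.category} (x : X ⟶ Y) (y : Y ⟶ Y) (h : x ≫ y = x) :
    ModelFrobenioid.baseMap y = 𝟙 Y.base := by
  have hb : ModelFrobenioid.baseMap x ≫ ModelFrobenioid.baseMap y = ModelFrobenioid.baseMap x ≫ 𝟙 Y.base := by
    rw [← ModelFrobenioid.baseMap_comp, h, Category.comp_id]
  haveI := C.isTotallyEpimorphic.epi (ModelFrobenioid.baseMap x)
  exact (cancel_epi (ModelFrobenioid.baseMap x)).mp hb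

/-- **Right-absorbed ⇒ pre-step** ([FrdI] Def. 1.2 (iii): linear base-isomorphism), in the [FrdI] operations
language `C.opsData` of the Cor. 3.8 rows. [cite: MochizukiFrdI2008, Def. 1.2 (iii) p.22] -/
theorem isPreStep_of_comp_eq_self {X Y : C.category} (x : X ⟶ Y) (y : Y ⟶ Y) (h : x ≫ y = x) :
    C.opsData.IsPreStep y := by
  refine ⟨C.degFr_eq_one_of_comp_eq_self x y h, ?_⟩
  change IsIso (ModelFrobenioid.baseMap y)
  rw [C.baseMap_eq_id_of_comp_eq_self x y h]
  infer_instance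

/-- **Right-absorbed ⇒ base-identity linear endomorphism**, i.e. `y ∈ O^▷`-shape data `(Base = id, deg_Fr = 1)`
([FrdI] Def. 1.2 (ii)). [cite: MochizukiFrdI2008, Def. 1.2 (ii) p.21] -/
theorem isBaseIdentity_and_isLinear_of_comp_eq_self {X Y : C.category} (x : X ⟶ Y) (y : Y ⟶ Y)
    (h : x ≫ y = x) : C.opsData.IsBaseIdentity y ∧ C.opsData.IsLinear y :=
  ⟨C.baseMap_eq_id_of_comp_eq_self x y h, C.degFr_eq_one_of_comp_eq_self x y h⟩

end TemperedFrobenioid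

/-! ## The Cor. 3.8 records: F-2809 holds on the right-absorbed arrows, for EVERY `h : Cor38Hyp C₁ C₂` -/

section Rows

variable {D₀' : Type u₀} [Category.{v₀} D₀'] {T' : RealifiedDivisorMonoids (D₀ := D₀') V}
  {D' : Type u} [Category.{v} D'] {VD' : FrdICatStub.{u, v, w} D'}
  {C₁ : TemperedFrobenioid T D VD} {C₂ : TemperedFrobenioid T' D' VD'}

namespace Cor38Hyp

variable (h : Cor38Hyp C₁ C₂)

/-- **F-2809 on right-absorbed arrows, direction `Ψ`.**  For EVERY record `h` (arbitrary equivalence `Ψ`, arbitrary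
typed data): if `x ≫ y = x` in `C₁` then `Ψ(y)` is a pre-step of `C₂` — functors transport `x ≫ y = x`.  No [FrdI]
Thm. 3.4 (ii) input. [cite: MochizukiEtTh2009, Cor 3.8 p.81] -/
theorem functor_map_isPreStep_of_comp_eq_self {X Y : C₁.category} (x : X ⟶ Y) (y : Y ⟶ Y) (hxy : x ≫ y = x) :
    C₂.opsData.IsPreStep (h.Ψ.functor.map y) :=
  C₂.isPreStep_of_comp_eq_self (h.Ψ.functor.map x) (h.Ψ.functor.map y) (by rw [← Functor.map_comp, hxy])

/-- **F-2809 on right-absorbed arrows, direction `Ψ⁻¹`.** [cite: MochizukiEtTh2009, Cor 3.8 p.81] -/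
theorem inverse_map_isPreStep_of_comp_eq_self {X Y : C₂.category} (x : X ⟶ Y) (y : Y ⟶ Y) (hxy : x ≫ y = x) :
    C₁.opsData.IsPreStep (h.Ψ.inverse.map y) :=
  C₁.isPreStep_of_comp_eq_self (h.Ψ.inverse.map x) (h.Ψ.inverse.map y) (by rw [← Functor.map_comp, hxy])

/-- **Both the source arrow and its image are pre-steps** (the shape of one instance of `PreservesMor` in
`h.PreservesPreSteps`, discharged on the right-absorbed class with no hypothesis on `h`).
[cite: MochizukiEtTh2009, Cor 3.8 p.81] -/
theorem isPreStep_and_functor_map_isPreStep_of_comp_eq_self {X Y : C₁.category} (x : X ⟶ Y) (y : Y ⟶ Y)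
    (hxy : x ≫ y = x) : C₁.opsData.IsPreStep y ∧ C₂.opsData.IsPreStep (h.Ψ.functor.map y) :=
  ⟨C₁.isPreStep_of_comp_eq_self x y hxy, h.functor_map_isPreStep_of_comp_eq_self x y hxy⟩

end Cor38Hyp

end Rows

end Literature.AnabelianGeometry.EtaleTheta
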